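import Mathlib.Analysis.Calculus.ImplicitContDiff
import Mathlib.Analysis.Calculus.Deriv.Polynomial
import Mathlib.Analysis.Matrix.Normed
import Mathlib.Topology.Algebra.Module.FiniteDimension
import Literature.Analysis.Matrix.HermitianPencil
import Literature.LinearAlgebra.Matrix.StrictlyHyperbolicPencil
import Literature.LinearAlgebra.Matrix.SimpleSpectrumProjections
import HarnessLib

/-!
# Smooth simple eigenvalue branches and eigenprojections of a strictly hyperbolic pencil

For a strictly hyperbolic real pencil `K(ξ) = Σⱼ ξⱼ Kⱼ` (`IsStrictlyHyperbolicPencil`: `k`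
pairwise distinct real eigenvalues at every `ξ ≠ 0`) and a point `ξ⁰ ≠ 0`, there is a ball
`B` around `ξ⁰` on which the eigenvalues of `K(ξ)` are `k` pairwise distinct `C^∞` (indeed
real-analytic) functions `μ₁(ξ), …, μ_k(ξ)` (`exists_smooth_simple_branches`): each eigenvalue
at `ξ⁰` is a SIMPLE root of the characteristic polynomial `p_ξ(z) = det(zI - K(ξ))`, a polynomial
in `(ξ, z)`, so the analytic implicit function theorem (`ContDiffAt.implicitFunction`) continues
it to an analytic root `μₐ(ξ)` near `ξ⁰`; for `ξ` near `ξ⁰` these `k` roots stay distinct and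
therefore exhaust the roots of the degree-`k` polynomial `p_ξ` (no perturbation theory of the
other points is needed). Consequently (`exists_strictSpectralData`) the Lagrange eigenprojections
`Πₐ(ξ) = ∏_{b ≠ a} (K(ξ) - μ_b(ξ))/(μₐ(ξ) - μ_b(ξ))` of the complexified pencil
(`Literature.LinearAlgebra.Matrix.lagrangeProj`, `SimpleSpectrumProjections.lean`) are complete
orthogonal idempotents with `K(ξ) = Σₐ μₐ(ξ)Πₐ(ξ)`, `Πₐ(ξ) ≠ 0`, and `C^∞` entries on `B`.
This is the smooth spectral decomposition which the rescaling argument of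
[BrennerThomeeWahlbin1975, Ch. 5 §1, proof of Lemma 1.1] needs, in the strictly hyperbolic
setting of [Brenner1973, Thm 3.1, Cor 3.1 p. 84] (Rauch's linear step for strictly hyperbolic
systems, `Rauch1986_LpMultiplier_forces_commutation`); cf. [Kato1966, Ch. II §1.4, §5.8
Thm 5.16] (analyticity of simple eigenvalues and their eigenprojections).

## References

* [Brenner1973] P. Brenner, Ark. Mat. 11 (1973) 75–101, Thm 3.1 and Cor 3.1 p. 84.
* [BrennerThomeeWahlbin1975] P. Brenner, V. Thomée, L. B. Wahlbin, LNM 434 (1975), Ch. 5 §1,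
  proof of Lemma 1.1 (first sentence).
* [Kato1966] T. Kato, *Perturbation Theory for Linear Operators* (1966), Ch. II §1.4, §5.8.
-/

noncomputable section

open Polynomial Filter Metric Set
open scoped Topology ContDiff

namespace Literature.Analysis.Matrix

open Literature.LinearAlgebra.Matrix

variable {d k : ℕ}

/-! ### The real pencil and its characteristic function -/

/-- The real pencil `K(ξ) = Σⱼ ξⱼ Kⱼ` on `ξ ∈ ℝᵈ = EuclideanSpace ℝ (Fin d)`. [folklore] -/
def rpencil (K : Fin d → Matrix (Fin k) (Fin k) ℝ) (ξ : EuclideanSpace ℝ (Fin d)) :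
    Matrix (Fin k) (Fin k) ℝ :=
  ∑ j, ξ j • K j

/-- The complexified pencil is the complexification of the real pencil. [folklore] -/
theorem pencil_map_eq (K : Fin d → Matrix (Fin k) (Fin k) ℝ) (ξ : EuclideanSpace ℝ (Fin d)) :
    pencil (fun j => (K j).map (algebraMap ℝ ℂ)) ξ = (rpencil K ξ).map (algebraMap ℝ ℂ) := by
  ext a b
  simp [pencil, rpencil, Matrix.sum_apply, Matrix.map_apply, Matrix.smul_apply]

/-- The characteristic polynomial of the complexified pencil. [folklore] -/
theorem charpoly_pencil_map (K : Fin d → Matrix (Fin k) (Fin k) ℝ) (ξ : EuclideanSpace ℝ (Fin d)) :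
    (pencil (fun j => (K j).map (algebraMap ℝ ℂ)) ξ).charpoly =
      (rpencil K ξ).charpoly.map (algebraMap ℝ ℂ) := by
  rw [pencil_map_eq, Matrix.charpoly_map]

/-- The characteristic function `F(ξ, z) = det(zI - K(ξ))`. [folklore] -/
def charFun (K : Fin d → Matrix (Fin k) (Fin k) ℝ) (u : EuclideanSpace ℝ (Fin d) × ℝ) : ℝ :=
  ((rpencil K u.1).charpoly).eval u.2

/-- `F(ξ, z) = det(zI - K(ξ))`. [folklore] -/
theorem charFun_eq_det (K : Fin d → Matrix (Fin k) (Fin k) ℝ) (u : EuclideanSpace ℝ (Fin d) × ℝ) :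
    charFun K u = (Matrix.scalar (Fin k) u.2 - rpencil K u.1).det :=
  Matrix.eval_charpoly _ _

/-- Entries of `zI - K(ξ)` as functions of `(ξ, z)`: `z δ_{ab} - Σⱼ ξⱼ (Kⱼ)_{ab}`. [folklore] -/
theorem scalar_sub_rpencil_apply (K : Fin d → Matrix (Fin k) (Fin k) ℝ)
    (u : EuclideanSpace ℝ (Fin d) × ℝ) (a b : Fin k) :
    (Matrix.scalar (Fin k) u.2 - rpencil K u.1) a b =
      u.2 * (if a = b then 1 else 0) - ∑ j, u.1 j * K j a b := by
  simp [rpencil, Matrix.scalar_apply, Matrix.sub_apply, Matrix.sum_apply, Matrix.smul_apply,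
    Matrix.diagonal_apply, mul_ite]

/-- The entries of `zI - K(ξ)` are real-analytic in `(ξ, z)`. [folklore] -/
theorem analyticAt_scalar_sub_rpencil_apply (K : Fin d → Matrix (Fin k) (Fin k) ℝ) (a b : Fin k)
    (u : EuclideanSpace ℝ (Fin d) × ℝ) :
    AnalyticAt ℝ (fun u => (Matrix.scalar (Fin k) u.2 - rpencil K u.1) a b) u := by
  simp_rw [scalar_sub_rpencil_apply]
  refine ((ContinuousLinearMap.snd ℝ _ ℝ).analyticAt u).mul analyticAt_const |>.sub ?_
  refine Finset.analyticAt_fun_sum _ fun j _ => ?_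
  exact (((EuclideanSpace.proj j).comp (ContinuousLinearMap.fst ℝ _ ℝ)).analyticAt u).mul
    analyticAt_const

/-- **The characteristic function is real-analytic** (a polynomial in `(ξ, z)`). [folklore] -/
theorem analyticAt_charFun (K : Fin d → Matrix (Fin k) (Fin k) ℝ) (u : EuclideanSpace ℝ (Fin d) × ℝ) :
    AnalyticAt ℝ (charFun K) u := by
  have h : charFun K = fun u => ∑ σ : Equiv.Perm (Fin k),
      ((Equiv.Perm.sign σ : ℤ) : ℝ) * ∏ i, (Matrix.scalar (Fin k) u.2 - rpencil K u.1) (σ i) i := by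
    funext u
    rw [charFun_eq_det, Matrix.det_apply]
    refine Finset.sum_congr rfl fun σ _ => ?_
    rw [Units.smul_def, zsmul_eq_mul]
  rw [h]
  refine Finset.analyticAt_fun_sum _ fun σ _ => analyticAt_const.mul ?_
  exact Finset.analyticAt_fun_prod _ fun i _ => analyticAt_scalar_sub_rpencil_apply K _ _ u

/-- The `z`-derivative of `F`: `∂F/∂z (ξ, z) = p_ξ'(z)`. [folklore] -/
theorem hasDerivAt_charFun (K : Fin d → Matrix (Fin k) (Fin k) ℝ) (ξ : EuclideanSpace ℝ (Fin d)) (z : ℝ) :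
    HasDerivAt (fun w => charFun K (ξ, w)) (((rpencil K ξ).charpoly.derivative).eval z) z := by
  change HasDerivAt (fun w => ((rpencil K ξ).charpoly).eval w) _ z
  exact Polynomial.hasDerivAt _ _

/-- `fderiv F (ξ, z) ∘ inr = p_ξ'(z) • id`. [folklore] -/
theorem fderiv_charFun_comp_inr (K : Fin d → Matrix (Fin k) (Fin k) ℝ) (ξ : EuclideanSpace ℝ (Fin d))
    (z : ℝ) :
    (fderiv ℝ (charFun K) (ξ, z)).comp (ContinuousLinearMap.inr ℝ _ ℝ) =
      (((rpencil K ξ).charpoly.derivative).eval z) • ContinuousLinearMap.id ℝ ℝ := by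
  have hd : HasFDerivAt (charFun K) (fderiv ℝ (charFun K) (ξ, z)) (ξ, z) :=
    ((analyticAt_charFun K (ξ, z)).differentiableAt).hasFDerivAt
  have hc : HasFDerivAt (fun w : ℝ => charFun K (ξ, w))
      ((fderiv ℝ (charFun K) (ξ, z)).comp (ContinuousLinearMap.inr ℝ _ ℝ)) z :=
    hd.comp z (hasFDerivAt_prodMk_right ξ z)
  have heq : ((fderiv ℝ (charFun K) (ξ, z)).comp (ContinuousLinearMap.inr ℝ _ ℝ)) 1 =
      ((rpencil K ξ).charpoly.derivative).eval z := hc.hasDerivAt.unique (hasDerivAt_charFun K ξ z)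
  ext
  simpa using heq

/-! ### Smooth simple branches near a point -/

/-- At a point where `p_{ξ⁰} = ∏_b (X - λ_b)` with distinct `λ_b`, the root `λₐ` is simple:
`p'_{ξ⁰}(λₐ) ≠ 0`. [folklore] -/
theorem derivative_eval_ne_zero_of_charpoly_eq_prod {K : Fin d → Matrix (Fin k) (Fin k) ℝ}
    {ξ : EuclideanSpace ℝ (Fin d)} {lam : Fin k → ℝ} (hinj : Function.Injective lam)
    (hchar : (rpencil K ξ).charpoly = ∏ b, (X - C (lam b))) (a : Fin k) :
    ((rpencil K ξ).charpoly.derivative).eval (lam a) ≠ 0 := by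
  rw [hchar, ← Lagrange.nodal_eq, Lagrange.eval_nodal_derivative_eval_node_eq (Finset.mem_univ a)]
  refine Lagrange.eval_nodal_not_at_node fun b hb => ?_
  exact fun h => (Finset.mem_erase.1 hb).1 (hinj h).symm

/-- **Analytic continuation of a simple eigenvalue** (implicit function theorem): a simple root
`λₐ` of `p_{ξ⁰}` continues to an analytic-at-`ξ⁰` function `ψ` with `ψ(ξ⁰) = λₐ` and
`p_ξ(ψ(ξ)) = 0` for `ξ` near `ξ⁰`. [cite: Kato1966, Ch. II §5.8 Thm 5.16] -/
theorem exists_root_germ {K : Fin d → Matrix (Fin k) (Fin k) ℝ} {ξ₀ : EuclideanSpace ℝ (Fin d)}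
    {lam : Fin k → ℝ} (hinj : Function.Injective lam)
    (hchar : (rpencil K ξ₀).charpoly = ∏ b, (X - C (lam b))) (a : Fin k) :
    ∃ ψ : EuclideanSpace ℝ (Fin d) → ℝ, ψ ξ₀ = lam a ∧ ContDiffAt ℝ ω ψ ξ₀ ∧
      ∀ᶠ ξ in 𝓝 ξ₀, charFun K (ξ, ψ ξ) = 0 := by
  have hroot : charFun K (ξ₀, lam a) = 0 := by
    change ((rpencil K ξ₀).charpoly).eval (lam a) = 0
    rw [hchar, eval_prod]
    exact Finset.prod_eq_zero (Finset.mem_univ a) (by simp)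
  have cdf : ContDiffAt ℝ ω (charFun K) (ξ₀, lam a) := (analyticAt_charFun K _).contDiffAt
  have hne := derivative_eval_ne_zero_of_charpoly_eq_prod hinj hchar a
  have if₂ : (fderiv ℝ (charFun K) (ξ₀, lam a) ∘L ContinuousLinearMap.inr ℝ _ ℝ).IsInvertible := by
    rw [fderiv_charFun_comp_inr]
    refine ContinuousLinearMap.IsInvertible.of_inverse
      (g := ((((rpencil K ξ₀).charpoly.derivative).eval (lam a)))⁻¹ • ContinuousLinearMap.id ℝ ℝ) ?_ ?_
    · ext; simp [hne]
    · ext; simp [hne]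
  have pn : (ω : WithTop ℕ∞) ≠ 0 := by simp
  refine ⟨cdf.implicitFunction pn if₂, cdf.implicitFunction_apply_self pn if₂,
    cdf.contDiffAt_implicitFunction pn if₂, ?_⟩
  have h := cdf.eventually_apply_implicitFunction pn if₂
  simp only [hroot] at h
  exact h

/-- **Smooth simple eigenvalue branches of a strictly hyperbolic pencil near `ξ⁰ ≠ 0`.** There is a
ball around `ξ⁰` on which the eigenvalues of `K(ξ)` are `k` pairwise distinct `C^∞` functions
`μₐ(ξ)`: `det(XI - K(ξ)) = ∏ₐ (X - μₐ(ξ))`.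
[cite: Kato1966, Ch. II §5.8 Thm 5.16; Brenner1973, Thm 3.1 p. 84] -/
theorem exists_smooth_simple_branches {K : Fin d → Matrix (Fin k) (Fin k) ℝ}
    (hK : IsStrictlyHyperbolicPencil K) {ξ₀ : EuclideanSpace ℝ (Fin d)} (hξ₀ : ξ₀ ≠ 0) :
    ∃ ρ > 0, ∃ μ : Fin k → EuclideanSpace ℝ (Fin d) → ℝ,
      (∀ a, ContDiffOn ℝ ∞ (μ a) (ball ξ₀ ρ)) ∧
      (∀ ξ ∈ ball ξ₀ ρ, Function.Injective fun a => μ a ξ) ∧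
      ∀ ξ ∈ ball ξ₀ ρ, (rpencil K ξ).charpoly = ∏ a, (X - C (μ a ξ)) := by
  -- the simple spectrum at `ξ₀`
  have hξ₀' : (WithLp.ofLp ξ₀ : Fin d → ℝ) ≠ 0 := fun h => hξ₀ (by
    have := congrArg (WithLp.toLp 2) h
    simpa using this)
  obtain ⟨lam, hinj, hchar⟩ := hK.charpoly_eq_prod hξ₀'
  have hchar' : (rpencil K ξ₀).charpoly = ∏ b, (X - C (lam b)) := hchar
  -- the germs
  choose ψ hψ0 hψω hψroot using fun a => exists_root_germ hinj hchar' a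
  -- eventually: roots, smooth, distinct
  have hsmooth : ∀ a, ∀ᶠ ξ in 𝓝 ξ₀, ContDiffAt ℝ ω (ψ a) ξ := fun a =>
    (hψω a).eventually (by simp)
  have hdist : ∀ a b, a ≠ b → ∀ᶠ ξ in 𝓝 ξ₀, ψ a ξ ≠ ψ b ξ := by
    intro a b hab
    have hcont : ContinuousAt (fun ξ => ψ a ξ - ψ b ξ) ξ₀ :=
      (hψω a).continuousAt.sub (hψω b).continuousAt
    have hne : ψ a ξ₀ - ψ b ξ₀ ≠ 0 := by
      rw [hψ0, hψ0, sub_ne_zero]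
      exact fun h => hab (hinj h)
    filter_upwards [hcont.tendsto.eventually_ne hne] with ξ hξ
    exact sub_ne_zero.1 hξ
  have hall : ∀ᶠ ξ in 𝓝 ξ₀, (∀ a, charFun K (ξ, ψ a ξ) = 0) ∧ (∀ a, ContDiffAt ℝ ω (ψ a) ξ) ∧
      ∀ ab : Fin k × Fin k, ab.1 ≠ ab.2 → ψ ab.1 ξ ≠ ψ ab.2 ξ := by
    refine (eventually_all.2 hψroot).and ((eventually_all.2 hsmooth).and ?_)
    refine eventually_all.2 fun ab => ?_
    by_cases hab : ab.1 = ab.2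
    · exact Eventually.of_forall fun ξ h => absurd hab h
    · filter_upwards [hdist ab.1 ab.2 hab] with ξ hξ _ using hξ
  obtain ⟨ρ, hρ, hball⟩ := Metric.eventually_nhds_iff_ball.1 hall
  refine ⟨ρ, hρ, ψ, fun a => ?_, fun ξ hξ => ?_, fun ξ hξ => ?_⟩
  · intro ξ hξ
    exact (((hball ξ hξ).2.1 a).of_le le_top).contDiffWithinAt
  · intro a b h
    by_contra hab
    exact (hball ξ hξ).2.2 (a, b) hab h
  · have hinj' : Function.Injective fun a => ψ a ξ := fun a b h => by
      by_contra hab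
      exact (hball ξ hξ).2.2 (a, b) hab h
    refine eq_prod_X_sub_C_of_injective_of_isRoot (Matrix.charpoly_monic _)
      ((Matrix.charpoly_natDegree_eq_dim _).trans (Fintype.card_fin k)) hinj' fun a => ?_
    exact (hball ξ hξ).1 a

/-! ### Smoothness of the Lagrange eigenprojections -/

section Smooth

open scoped Matrix.Norms.Operator

/-- The complexified pencil is smooth in `ξ` (matrix-valued). [folklore] -/
theorem contDiff_pencil_map (K : Fin d → Matrix (Fin k) (Fin k) ℝ) {n : WithTop ℕ∞} :
    ContDiff ℝ n (pencil (fun j => (K j).map (algebraMap ℝ ℂ))) := by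
  unfold pencil
  refine ContDiff.sum fun j _ => ?_
  exact (Complex.ofRealCLM.contDiff.comp (EuclideanSpace.proj j).contDiff).smul
    (contDiff_const (c := (K j).map (algebraMap ℝ ℂ)))

/-- A product of a list of `C^n` matrix-valued functions is `C^n`. [folklore] -/
theorem contDiffOn_list_prod' {n : WithTop ℕ∞} {s : Set (EuclideanSpace ℝ (Fin d))}
    (l : List (EuclideanSpace ℝ (Fin d) → Matrix (Fin k) (Fin k) ℂ))
    (h : ∀ f ∈ l, ContDiffOn ℝ n f s) :
    ContDiffOn ℝ n (fun ξ => (l.map fun f => f ξ).prod) s := by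
  induction l with
  | nil => simpa using contDiffOn_const
  | cons f l ih =>
      have hf : ContDiffOn ℝ n f s := h f (by simp)
      have hl : ContDiffOn ℝ n (fun ξ => (l.map fun g => g ξ).prod) s :=
        ih fun g hg => h g (by simp [hg])
      simpa [List.map_cons, List.prod_cons] using hf.mul hl

/-- **The Lagrange eigenprojections of smooth distinct branches have smooth entries**: if the
`μₐ` are `C^∞` and pairwise distinct on `s`, then so are the entries of
`lagrangeProj K_ℂ(ξ) μ(ξ) a`. [folklore] -/
theorem contDiffOn_lagrangeProj_apply (K : Fin d → Matrix (Fin k) (Fin k) ℝ)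
    {s : Set (EuclideanSpace ℝ (Fin d))} {μ : Fin k → EuclideanSpace ℝ (Fin d) → ℝ}
    (hsmooth : ∀ a, ContDiffOn ℝ ∞ (μ a) s)
    (hinj : ∀ ξ ∈ s, Function.Injective fun a => μ a ξ) (a i i' : Fin k) :
    ContDiffOn ℝ ∞ (fun ξ => lagrangeProj (pencil (fun j => (K j).map (algebraMap ℝ ℂ)) ξ)
      (fun b => ((μ b ξ : ℝ) : ℂ)) a i i') s := by
  set M : EuclideanSpace ℝ (Fin d) → Matrix (Fin k) (Fin k) ℂ := pencil (fun j => (K j).map (algebraMap ℝ ℂ))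
    with hM
  have hμC : ∀ b, ContDiffOn ℝ ∞ (fun ξ => ((μ b ξ : ℝ) : ℂ)) s := fun b =>
    Complex.ofRealCLM.contDiff.comp_contDiffOn (hsmooth b)
  have hfac : ∀ b, b ≠ a → ContDiffOn ℝ ∞ (fun ξ => (((μ a ξ : ℝ) : ℂ) - ((μ b ξ : ℝ) : ℂ))⁻¹ •
      (M ξ - ((μ b ξ : ℝ) : ℂ) • (1 : Matrix (Fin k) (Fin k) ℂ))) s := by
    intro b hb
    have h1 : ContDiffOn ℝ ∞ (fun ξ => (((μ a ξ : ℝ) : ℂ) - ((μ b ξ : ℝ) : ℂ))⁻¹) s := by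
      refine ((hμC a).sub (hμC b)).inv fun ξ hξ => sub_ne_zero.2 fun h => hb ?_
      have h' : μ a ξ = μ b ξ := by exact_mod_cast h
      exact (hinj ξ hξ h').symm
    have h2 : ContDiffOn ℝ ∞ (fun ξ => M ξ - ((μ b ξ : ℝ) : ℂ) • (1 : Matrix (Fin k) (Fin k) ℂ)) s :=
      (contDiff_pencil_map K).contDiffOn.sub
        ((hμC b).smul (contDiffOn_const (c := (1 : Matrix (Fin k) (Fin k) ℂ))))
    exact h1.smul h2
  set l : List (EuclideanSpace ℝ (Fin d) → Matrix (Fin k) (Fin k) ℂ) :=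
    (Finset.univ.erase a).toList.map fun b ξ =>
      (((μ a ξ : ℝ) : ℂ) - ((μ b ξ : ℝ) : ℂ))⁻¹ • (M ξ - ((μ b ξ : ℝ) : ℂ) • (1 : Matrix (Fin k) (Fin k) ℂ))
    with hl
  have heq : (fun ξ => lagrangeProj (M ξ) (fun b => ((μ b ξ : ℝ) : ℂ)) a) =
      fun ξ => (l.map fun f => f ξ).prod := by
    funext ξ
    rw [lagrangeProj_eq_list_prod, hl, List.map_map]
    rfl
  have hmat : ContDiffOn ℝ ∞ (fun ξ => lagrangeProj (M ξ) (fun b => ((μ b ξ : ℝ) : ℂ)) a) s := by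
    rw [heq]
    refine contDiffOn_list_prod' l fun f hf => ?_
    rw [hl, List.mem_map] at hf
    obtain ⟨b, hb, rfl⟩ := hf
    rw [Finset.mem_toList, Finset.mem_erase] at hb
    exact hfac b hb.1
  set L : Matrix (Fin k) (Fin k) ℂ →L[ℝ] ℂ :=
    LinearMap.toContinuousLinearMap (Matrix.entryLinearMap ℝ ℂ i i') with hL
  exact L.contDiff.comp_contDiffOn hmat

end Smooth

/-! ### The smooth spectral data -/

/-- **Smooth spectral data of a strictly hyperbolic pencil near `ξ⁰ ≠ 0`**: a ball `B`, `k`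
smooth real branches `μₐ`, pairwise distinct on `B`, with
`det(XI - K_ℂ(ξ)) = ∏ₐ (X - μₐ(ξ))` for the complexified pencil `K_ℂ(ξ) = Σ ξⱼ (Kⱼ ⊗ ℂ)`, the
Lagrange eigenprojections `Πₐ(ξ) = lagrangeProj K_ℂ(ξ) μ(ξ) a` being complete orthogonal
idempotents with `K_ℂ(ξ) = Σ μₐ(ξ)Πₐ(ξ)`, `Πₐ(ξ) ≠ 0`, and `C^∞` entries on `B`.
[cite: Kato1966, Ch. II §1.4 and §5.8 Thm 5.16; Brenner1973, Thm 3.1 p. 84] -/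
theorem exists_strictSpectralData {K : Fin d → Matrix (Fin k) (Fin k) ℝ}
    (hK : IsStrictlyHyperbolicPencil K) {ξ₀ : EuclideanSpace ℝ (Fin d)} (hξ₀ : ξ₀ ≠ 0) :
    ∃ ρ > 0, ∃ μ : Fin k → EuclideanSpace ℝ (Fin d) → ℝ,
      (∀ a, ContDiffOn ℝ ∞ (μ a) (ball ξ₀ ρ)) ∧
      (∀ ξ ∈ ball ξ₀ ρ, Function.Injective fun a => ((μ a ξ : ℝ) : ℂ)) ∧
      (∀ ξ ∈ ball ξ₀ ρ, (pencil (fun j => (K j).map (algebraMap ℝ ℂ)) ξ).charpoly =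
        ∏ a, (X - C ((μ a ξ : ℝ) : ℂ))) ∧
      (∀ a (i i' : Fin k), ContDiffOn ℝ ∞ (fun ξ => lagrangeProj (pencil (fun j => (K j).map
        (algebraMap ℝ ℂ)) ξ) (fun b => ((μ b ξ : ℝ) : ℂ)) a i i') (ball ξ₀ ρ)) := by
  obtain ⟨ρ, hρ, μ, hsmooth, hinj, hchar⟩ := exists_smooth_simple_branches hK hξ₀
  have hinjC : ∀ ξ ∈ ball ξ₀ ρ, Function.Injective fun a => ((μ a ξ : ℝ) : ℂ) := by
    intro ξ hξ a b h
    have h' : ((μ a ξ : ℝ) : ℂ) = ((μ b ξ : ℝ) : ℂ) := h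
    exact hinj ξ hξ (by exact_mod_cast h')
  have hcharC : ∀ ξ ∈ ball ξ₀ ρ, (pencil (fun j => (K j).map (algebraMap ℝ ℂ)) ξ).charpoly =
      ∏ a, (X - C ((μ a ξ : ℝ) : ℂ)) := fun ξ hξ => by
    rw [charpoly_pencil_map, hchar ξ hξ, Polynomial.map_prod]
    simp
  exact ⟨ρ, hρ, μ, hsmooth, hinjC, hcharC, fun a i i' =>
    contDiffOn_lagrangeProj_apply K hsmooth hinj a i i'⟩

end Literature.Analysis.Matrix

end
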